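import Summits.CriticalPhenomena.SAWScalingLimit.Theorems.SAWLeftRightFKGLeftRightFKGBoxCornerMinor
import HarnessLib

/-!
# Crux `LeftRightFKG` (stmt-CriticalPhenomena-11232), line `corner-localisation` (lead c4, v9i):
the bottom-corner `2 × 2` minor from ONE inequality, at every fugacity (`stub_cornerMinorOfIneq`, T11)

Fugacity-free refactor of the landed `Families.stub_boxCornerMinor` (T8). The box is realised ABSTRACTLY:
the only hypothesis on the boundary walk `C` is that adjacency in `(dom C 1)_1` is lattice adjacency inside
the open box `(x₀, x₁) × (y₀, y₁)` (`hadj`); the marked points are the bottom corners `a = (x₀+1, y₀+1)`,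
`b = (x₁-1, y₀+1)`. Every vertex of a chord is `a` or the head of a dart, hence in the box (`endSteps`), so
at height `≥ y₀ + 1`; a chord leaves `a` East (`u₁ = (x₀+2, y₀+1)`) or North (`u₂ = (x₀+1, y₀+2)`) and enters
`b` from the West (`w₁ = (x₁-2, y₀+1)`) or from the North (`w₂ = (x₁-1, y₀+2)`).

(i) `E = {first step North}` and `F = {last step from the North}` are `≼`-up-closed (`isUp_pair`): by the
landed `Families.stub_firstStepMonotone`, "East start" and "West arrival" pass from `γ₂` to `γ₁`.

(ii) For every `0 < x`, the single inequality `μ(E) μ(F) ≤ μ(univ) μ(E ∩ F)` of the fugacity-`x` chord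
measure `μ = μx x` reads, after partitioning chords by their end-steps `(u', w') ∈ {u₁, u₂} × {w₁, w₂}`
(`BoxCornerMinor.pointwise2`), `(M₂₁ + M₂₂)(M₁₂ + M₂₂) ≤ (M₁₁ + M₁₂ + M₂₁ + M₂₂) M₂₂`, i.e.
`M₂₁ M₁₂ ≤ M₁₁ M₂₂`; and the class dictionary at `k = m = 0` (`CornerLoc.stub_classDictionary`,
`CornerAssembly.sum_dirSet_eq`, two distinct chords by `BoxCornerMinor.two_chords_corners`) gives
`M(u', w') = x² Z(u', w')`, `Z = pathKernel G x` for the free graph `G` (box graph with `a, b` isolated):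
the corner minor `Z(u₂,w₁) Z(u₁,w₂) ≤ Z(u₁,w₁) Z(u₂,w₂)` (`minor_of_ineq`). Elementary given the landed
stubs ("folklore").
-/

noncomputable section

open MeasureTheory SimpleGraph
open Literature.Probability.LatticeModels Literature.Probability.RandomPlanarGeometry
open Summit.CriticalPhenomena.SAWScalingLimit.Theorems.LeftRightFKG.Negative (bx pathCross wcross)
open Summit.CriticalPhenomena.SAWScalingLimit.Theorems.LeftRightFKG.CornerLoc
open Summit.CriticalPhenomena.SAWScalingLimit.Theorems.BoundaryTP2 (pathKernel pathKernelOn)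
open scoped Classical ENNReal

namespace Summit.CriticalPhenomena.SAWScalingLimit.Theorems.LeftRightFKG.Families

namespace CornerMinorOfIneq

open BoxLeafThreePoint BoxCornerMinor

/-- END-STEPS OF A CHORD BETWEEN THE BOTTOM CORNERS of an abstractly realised box (`Ω_1` = lattice adjacency
inside the open box): every vertex of the chord has height `≥ a 1 = b 1 = y₀ + 1` (it is `a` or the head of
a dart, hence a box site), the first step is `u₁` (East) or `u₂` (North), the last step comes from `w₁`
(West) or `w₂` (North), and both end-steps are steps of `Ω_1`. [folklore] -/
theorem endSteps {Ω : Set ℂ} {x₀ x₁ y₀ y₁ : ℤ}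
    (hadj : ∀ p q : Site 2, (discreteDomainGraph Ω 1).Adj p q ↔
      (zdGraph 2).Adj p q ∧ p ∈ Negative.Rect.box x₀ x₁ y₀ y₁ ∧ q ∈ Negative.Rect.box x₀ x₁ y₀ y₁)
    (hx : x₀ + 4 ≤ x₁) {a b u₁ u₂ w₁ w₂ : Site 2} (ha : a = bx (x₀ + 1) (y₀ + 1))
    (hb : b = bx (x₁ - 1) (y₀ + 1)) (hu₁ : u₁ = bx (x₀ + 2) (y₀ + 1)) (hu₂ : u₂ = bx (x₀ + 1) (y₀ + 2))
    (hw₁ : w₁ = bx (x₁ - 2) (y₀ + 1)) (hw₂ : w₂ = bx (x₁ - 1) (y₀ + 2)) (γ : SAW.DomainSAW Ω 1 a b) :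
    (∀ v ∈ γ.walk.support, a 1 ≤ v 1) ∧ (∀ v ∈ γ.walk.support, b 1 ≤ v 1) ∧
    (discreteDomainGraph Ω 1).Adj a (γ.walk.getVert 1) ∧
    (discreteDomainGraph Ω 1).Adj (γ.walk.reverse.getVert 1) b ∧
    (γ.walk.getVert 1 = u₁ ∨ γ.walk.getVert 1 = u₂) ∧
    (γ.walk.reverse.getVert 1 = w₁ ∨ γ.walk.reverse.getVert 1 = w₂) := by
  obtain ⟨ha0, ha1⟩ : a 0 = x₀ + 1 ∧ a 1 = y₀ + 1 := by subst ha; exact ⟨rfl, rfl⟩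
  obtain ⟨hb0, hb1⟩ : b 0 = x₁ - 1 ∧ b 1 = y₀ + 1 := by subst hb; exact ⟨rfl, rfl⟩
  have hbox : ∀ p : Site 2, p ∈ Negative.Rect.box x₀ x₁ y₀ y₁ ↔
      (x₀ < p 0 ∧ p 0 < x₁) ∧ (y₀ < p 1 ∧ p 1 < y₁) := fun p => Iff.rfl
  have hab : a ≠ b := site_ne (Or.inl (by omega))
  have hlen : 0 < γ.walk.length :=
    Nat.pos_of_ne_zero fun h0 => hab (γ.walk.eq_of_length_eq_zero h0)
  have hadj1 : (discreteDomainGraph Ω 1).Adj a (γ.walk.getVert 1) := by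
    have h := γ.walk.adj_getVert_succ hlen
    rwa [Walk.getVert_zero] at h
  have hadj1R : (discreteDomainGraph Ω 1).Adj (γ.walk.reverse.getVert 1) b := by
    have h := γ.walk.reverse.adj_getVert_succ (i := 0) (by rw [Walk.length_reverse]; exact hlen)
    rw [Walk.getVert_zero] at h
    exact h.symm
  -- heights: a vertex of the chord is `a` or the head of one of its darts, a box site
  have hY : ∀ v ∈ γ.walk.support, a 1 ≤ v 1 := by
    intro v hv
    rw [← γ.walk.cons_tail_support, List.mem_cons, ← Walk.map_snd_darts, List.mem_map] at hv
    rcases hv with rfl | ⟨d, -, rfl⟩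
    · exact le_rfl
    · have h := ((hbox _).1 ((hadj _ _).1 d.adj).2.2).2.1
      omega
  refine ⟨hY, fun v hv => by rw [hb1, ← ha1]; exact hY v hv, hadj1, hadj1R, ?_, ?_⟩
  · have hfbox : γ.walk.getVert 1 ∈ Negative.Rect.box x₀ x₁ y₀ y₁ := ((hadj _ _).1 hadj1).2.2
    have h := nbr_cases ((hadj _ _).1 hadj1).1 hfbox ha1
    rw [ha0, show x₀ + 1 + 1 = x₀ + 2 by omega, ← hu₁, ← hu₂] at h
    rcases h with h | h | h
    · exact Or.inl h
    · exact Or.inr h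
    · exfalso
      rw [h] at hfbox
      have h' := ((hbox _).1 hfbox).1.1
      rw [Negative.bx_zero] at h'
      omega
  · have hlbox : γ.walk.reverse.getVert 1 ∈ Negative.Rect.box x₀ x₁ y₀ y₁ := ((hadj _ _).1 hadj1R).2.1
    have h := nbr_cases ((hadj _ _).1 hadj1R).1.symm hlbox hb1
    rw [hb0, show x₁ - 1 - 1 = x₁ - 2 by omega, ← hw₁, ← hw₂] at h
    rcases h with h | h | h
    · exfalso
      rw [h] at hlbox
      have h' := ((hbox _).1 hlbox).1.2
      rw [Negative.bx_zero] at h'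
      omega
    · exact Or.inr h
    · exact Or.inl h

/-- THE TWO CORNER EVENTS ARE `≼`-UP-CLOSED: `E = {first step North}` (the only alternative is East, and
"East start" passes from `γ₂` to `γ₁`) and `F = {last step from the North}` (the alternative is from the
West, which passes from `γ₂` to `γ₁`) — the landed first/last-step monotonicity at a bottom-row marked
point (`Families.stub_firstStepMonotone`). [folklore] -/
theorem isUp_pair {Ω : Set ℂ} {x₀ x₁ y₀ y₁ : ℤ}
    (hadj : ∀ p q : Site 2, (discreteDomainGraph Ω 1).Adj p q ↔
      (zdGraph 2).Adj p q ∧ p ∈ Negative.Rect.box x₀ x₁ y₀ y₁ ∧ q ∈ Negative.Rect.box x₀ x₁ y₀ y₁)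
    (hx : x₀ + 4 ≤ x₁) {a b u₁ u₂ w₁ w₂ : Site 2} (ha : a = bx (x₀ + 1) (y₀ + 1))
    (hb : b = bx (x₁ - 1) (y₀ + 1)) (hu₁ : u₁ = bx (x₀ + 2) (y₀ + 1)) (hu₂ : u₂ = bx (x₀ + 1) (y₀ + 2))
    (hw₁ : w₁ = bx (x₁ - 2) (y₀ + 1)) (hw₂ : w₂ = bx (x₁ - 1) (y₀ + 2))
    {E F : Set (SAW.DomainSAW Ω 1 a b)} (hE : ∀ γ, γ ∈ E ↔ γ.walk.getVert 1 = u₂)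
    (hF : ∀ γ, γ ∈ F ↔ γ.walk.reverse.getVert 1 = w₂) : IsUp E ∧ IsUp F := by
  obtain ⟨ha0, ha1⟩ : a 0 = x₀ + 1 ∧ a 1 = y₀ + 1 := by subst ha; exact ⟨rfl, rfl⟩
  obtain ⟨hb0, hb1⟩ : b 0 = x₁ - 1 ∧ b 1 = y₀ + 1 := by subst hb; exact ⟨rfl, rfl⟩
  obtain ⟨hu₁0, hu₂0, hw₁0, hw₂0⟩ : u₁ 0 = x₀ + 2 ∧ u₂ 0 = x₀ + 1 ∧ w₁ 0 = x₁ - 2 ∧ w₂ 0 = x₁ - 1 := by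
    subst hu₁ hu₂ hw₁ hw₂; exact ⟨rfl, rfl, rfl, rfl⟩
  obtain ⟨hab, hu12, hw12⟩ : a ≠ b ∧ u₁ ≠ u₂ ∧ w₁ ≠ w₂ :=
    ⟨site_ne (Or.inl (by omega)), site_ne (Or.inl (by omega)), site_ne (Or.inl (by omega))⟩
  have hS := endSteps hadj hx ha hb hu₁ hu₂ hw₁ hw₂
  refine ⟨fun γ₁ γ₂ hlr h₁ => ?_, fun γ₁ γ₂ hlr h₁ => ?_⟩
  · rw [hE] at h₁ ⊢
    rcases (hS γ₂).2.2.2.2.1 with h₂ | h₂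
    · have key := ((stub_firstStepMonotone Ω a b γ₁ γ₂ hab hlr).1 (hS γ₁).1 (hS γ₂).1).2
      rw [ha0, ha1, show x₀ + 1 + 1 = x₀ + 2 by omega, ← hu₁] at key
      exact absurd ((key h₂).symm.trans h₁) hu12
    · exact h₂
  · rw [hF] at h₁ ⊢
    rcases (hS γ₂).2.2.2.2.2 with h₂ | h₂
    · have key := ((stub_firstStepMonotone Ω a b γ₁ γ₂ hab hlr).2 (hS γ₁).2.1 (hS γ₂).2.1).2
      rw [hb0, hb1, show x₁ - 1 - 1 = x₁ - 2 by omega, ← hw₁] at key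
      exact absurd ((key h₂).symm.trans h₁) hw12
    · exact h₂

/-- BOOKKEEPING AT FUGACITY `x`: for the box realised as `dom C 1` (adjacency of `Ω_1` = lattice adjacency
inside the open box) with the bottom corners as marked points, the single inequality
`μ(E) μ(F) ≤ μ(univ) μ(E ∩ F)` of `μ = μx x` for `E = {first step u₂}`, `F = {last step from w₂}` is,
through the end-step matrix `M(u', w') = x² Z(u', w')` (class dictionary at `k = m = 0`), the corner minor
`Z(u₂,w₁) Z(u₁,w₂) ≤ Z(u₁,w₁) Z(u₂,w₂)` of `Z = pathKernel G x`, `G` the free graph. [folklore] -/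
theorem minor_of_ineq {x : ℝ} (hx0 : 0 < x) {x₀ x₁ y₀ y₁ : ℤ} {C : (zdGraph 2).Walk (bx x₀ y₀) (bx x₀ y₀)}
    (hadj : ∀ p q : Site 2, (discreteDomainGraph (dom C 1) 1).Adj p q ↔
      (zdGraph 2).Adj p q ∧ p ∈ Negative.Rect.box x₀ x₁ y₀ y₁ ∧ q ∈ Negative.Rect.box x₀ x₁ y₀ y₁)
    (hx : x₀ + 4 ≤ x₁) (hy : y₀ + 2 < y₁) {a b u₁ u₂ w₁ w₂ : Site 2} (ha : a = bx (x₀ + 1) (y₀ + 1))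
    (hb : b = bx (x₁ - 1) (y₀ + 1)) (hu₁ : u₁ = bx (x₀ + 2) (y₀ + 1)) (hu₂ : u₂ = bx (x₀ + 1) (y₀ + 2))
    (hw₁ : w₁ = bx (x₁ - 2) (y₀ + 1)) (hw₂ : w₂ = bx (x₁ - 1) (y₀ + 2))
    {E F : Set (SAW.DomainSAW (dom C 1) 1 a b)} (hE : ∀ γ, γ ∈ E ↔ γ.walk.getVert 1 = u₂)
    (hF : ∀ γ, γ ∈ F ↔ γ.walk.reverse.getVert 1 = w₂)
    (key : μx x (dom C 1) 1 a b E * μx x (dom C 1) 1 a b F ≤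
      μx x (dom C 1) 1 a b Set.univ * μx x (dom C 1) 1 a b (E ∩ F))
    {G : SimpleGraph (Site 2)} (hG : G = freeGraph (dom C 1) 1 0 (fun _ => a) 0 (fun _ => b)) :
    pathKernel G x u₂ w₁ * pathKernel G x u₁ w₂ ≤ pathKernel G x u₁ w₁ * pathKernel G x u₂ w₂ := by
  -- coordinates of the six sites
  obtain ⟨ha0, ha1⟩ : a 0 = x₀ + 1 ∧ a 1 = y₀ + 1 := by subst ha; exact ⟨rfl, rfl⟩
  obtain ⟨hb0, hb1⟩ : b 0 = x₁ - 1 ∧ b 1 = y₀ + 1 := by subst hb; exact ⟨rfl, rfl⟩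
  obtain ⟨hu₁0, hu₁1⟩ : u₁ 0 = x₀ + 2 ∧ u₁ 1 = y₀ + 1 := by subst hu₁; exact ⟨rfl, rfl⟩
  obtain ⟨hu₂0, hu₂1⟩ : u₂ 0 = x₀ + 1 ∧ u₂ 1 = y₀ + 2 := by subst hu₂; exact ⟨rfl, rfl⟩
  obtain ⟨hw₁0, hw₁1⟩ : w₁ 0 = x₁ - 2 ∧ w₁ 1 = y₀ + 1 := by subst hw₁; exact ⟨rfl, rfl⟩
  obtain ⟨hw₂0, hw₂1⟩ : w₂ 0 = x₁ - 1 ∧ w₂ 1 = y₀ + 2 := by subst hw₂; exact ⟨rfl, rfl⟩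
  have hbox : ∀ p : Site 2, p ∈ Negative.Rect.box x₀ x₁ y₀ y₁ ↔
      (x₀ < p 0 ∧ p 0 < x₁) ∧ (y₀ < p 1 ∧ p 1 < y₁) := fun p => Iff.rfl
  obtain ⟨hu12, hw12⟩ : u₁ ≠ u₂ ∧ w₁ ≠ w₂ := ⟨site_ne (Or.inl (by omega)), site_ne (Or.inl (by omega))⟩
  obtain ⟨hu1a, hu1b, hu2a, hu2b, hw1a, hw1b, hw2a, hw2b⟩ :
      u₁ ≠ a ∧ u₁ ≠ b ∧ u₂ ≠ a ∧ u₂ ≠ b ∧ w₁ ≠ a ∧ w₁ ≠ b ∧ w₂ ≠ a ∧ w₂ ≠ b :=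
    ⟨site_ne (Or.inl (by omega)), site_ne (Or.inl (by omega)), site_ne (Or.inr (by omega)),
      site_ne (Or.inr (by omega)), site_ne (Or.inl (by omega)), site_ne (Or.inl (by omega)),
      site_ne (Or.inr (by omega)), site_ne (Or.inr (by omega))⟩
  -- lattice adjacencies and box memberships of the named sites
  have hAau1 : (zdGraph 2).Adj a u₁ := by rw [ha, hu₁]; exact Negative.adj_bx _ _ _ _ (by omega)
  have hAau2 : (zdGraph 2).Adj a u₂ := by rw [ha, hu₂]; exact Negative.adj_bx _ _ _ _ (by omega)
  have hAw1b : (zdGraph 2).Adj w₁ b := by rw [hw₁, hb]; exact Negative.adj_bx _ _ _ _ (by omega)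
  have hAw2b : (zdGraph 2).Adj w₂ b := by rw [hw₂, hb]; exact Negative.adj_bx _ _ _ _ (by omega)
  obtain ⟨habox, hbbox, hu1box, hu2box, hw1box, hw2box⟩ : a ∈ Negative.Rect.box x₀ x₁ y₀ y₁ ∧
      b ∈ Negative.Rect.box x₀ x₁ y₀ y₁ ∧ u₁ ∈ Negative.Rect.box x₀ x₁ y₀ y₁ ∧
      u₂ ∈ Negative.Rect.box x₀ x₁ y₀ y₁ ∧ w₁ ∈ Negative.Rect.box x₀ x₁ y₀ y₁ ∧
      w₂ ∈ Negative.Rect.box x₀ x₁ y₀ y₁ :=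
    ⟨(hbox a).2 (by omega), (hbox b).2 (by omega), (hbox u₁).2 (by omega), (hbox u₂).2 (by omega),
      (hbox w₁).2 (by omega), (hbox w₂).2 (by omega)⟩
  clear hu₁1 hu₂1 hw₁1 hw₂1
  -- chords: finiteness, first and last steps
  haveI : Finite (SAW.DomainSAW (dom C 1) 1 a b) := finite_domainSAW C one_pos
  haveI : Fintype (SAW.DomainSAW (dom C 1) 1 a b) := Fintype.ofFinite _
  have hS := endSteps hadj hx ha hb hu₁ hu₂ hw₁ hw₂
  -- the inequality in terms of real partition functions
  rw [μx_apply_eq_ofReal hx0.le E, μx_apply_eq_ofReal hx0.le F, μx_apply_eq_ofReal hx0.le Set.univ,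
    μx_apply_eq_ofReal hx0.le (E ∩ F),
    ← ENNReal.ofReal_mul (Finset.sum_nonneg fun γ _ => pow_nonneg hx0.le _),
    ← ENNReal.ofReal_mul (Finset.sum_nonneg fun γ _ => pow_nonneg hx0.le _),
    ENNReal.ofReal_le_ofReal_iff (mul_nonneg (Finset.sum_nonneg fun γ _ => pow_nonneg hx0.le _)
      (Finset.sum_nonneg fun γ _ => pow_nonneg hx0.le _))] at key
  simp only [Finset.sum_filter, hE, hF, Set.mem_inter_iff, Set.mem_univ, if_true] at key
  -- the end-step matrix `M`, the kernels `Z` of the free graph; the four sums in terms of the four entries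
  obtain ⟨M, hM⟩ : ∃ M : Site 2 → Site 2 → ℝ, ∀ p q, M p q =
      ∑ γ : SAW.DomainSAW (dom C 1) 1 a b,
        if γ.walk.getVert 1 = p ∧ γ.walk.reverse.getVert 1 = q then x ^ γ.length else 0 :=
    ⟨_, fun _ _ => rfl⟩
  obtain ⟨Z, hZ⟩ : ∃ Z : Site 2 → Site 2 → ℝ, ∀ p q, Z p q = (pathKernel G x p q).toReal :=
    ⟨_, fun _ _ => rfl⟩
  have hpw := fun γ : SAW.DomainSAW (dom C 1) 1 a b =>
    pointwise2 (x ^ γ.length) (hS γ).2.2.2.2.1 (hS γ).2.2.2.2.2 hu12 hw12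
  rw [Fintype.sum_congr _ _ fun γ => (hpw γ).1, Fintype.sum_congr _ _ fun γ => (hpw γ).2.1,
    Fintype.sum_congr _ _ fun γ => (hpw γ).2.2] at key
  simp only [Finset.sum_add_distrib, ← hM] at key
  have ineq : M u₂ w₁ * M u₁ w₂ ≤ M u₁ w₁ * M u₂ w₂ := by nlinarith [key]
  clear key hpw
  -- the class dictionary at `k = m = 0`: entries are `x²` times kernels of the free graph
  have hGfin' : (freeGraph (dom C 1) 1 0 (fun _ => a) 0 (fun _ => b)).support.Finite :=
    support_freeGraph_finite (isBounded_dom C 1) one_pos 0 _ 0 _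
  have hGfin : G.support.Finite := by rw [hG]; exact hGfin'
  have hfix : ∀ p : Site 2, p ≠ a → p ≠ b → p ∉ fixedSet 0 (fun _ : ℕ => a) 0 (fun _ : ℕ => b) := by
    rintro p hpa hpb (⟨_, _, h⟩ | ⟨_, _, h⟩)
    exacts [hpa h.symm, hpb h.symm]
  have h2 : ∃ γ₁ γ₂ : SAW.DomainSAW (dom C 1) 1 a b,
      γ₁ ∈ cls 0 (fun _ => a) 0 (fun _ => b) ∧ γ₂ ∈ cls 0 (fun _ => a) 0 (fun _ => b) ∧ γ₁ ≠ γ₂ := by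
    obtain ⟨γ₁, γ₂, h12⟩ := two_chords_corners hadj hx hy ha hb
    exact ⟨γ₁, γ₂, by rw [cls_zero]; exact Set.mem_univ _, by rw [cls_zero]; exact Set.mem_univ _, h12⟩
  have hdict : ∀ p q : Site 2, p ≠ a → p ≠ b → q ≠ a → q ≠ b →
      (discreteDomainGraph (dom C 1) 1).Adj a p → (discreteDomainGraph (dom C 1) 1).Adj q b →
      M p q = x ^ 2 * Z p q := by
    intro p q hpa hpb hqa hqb hap hqb'
    have hkey := CornerAssembly.sum_dirSet_eq (k := 0) (π := fun _ => a) (m := 0) (σ := fun _ => b)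
      (stub_classDictionary (dom C 1) 1 a b) h2 hGfin' hx0.le (hfix p hpa hpb) (hfix q hqa hqb) hap hqb'
    simp only [zero_add] at hkey
    rw [hM, hZ, hG, ← hkey, Finset.sum_filter]
    exact Finset.sum_congr rfl fun γ _ =>
      if_congr (by simp only [mem_dirSet, cls_zero, Set.mem_univ, true_and, zero_add]) rfl rfl
  have hDa : ∀ p : Site 2, (zdGraph 2).Adj a p → p ∈ Negative.Rect.box x₀ x₁ y₀ y₁ →
      (discreteDomainGraph (dom C 1) 1).Adj a p := fun p h hp => (hadj a p).2 ⟨h, habox, hp⟩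
  have hDb : ∀ q : Site 2, (zdGraph 2).Adj q b → q ∈ Negative.Rect.box x₀ x₁ y₀ y₁ →
      (discreteDomainGraph (dom C 1) 1).Adj q b := fun q h hq => (hadj q b).2 ⟨h, hq, hbbox⟩
  have v11 := hdict u₁ w₁ hu1a hu1b hw1a hw1b (hDa u₁ hAau1 hu1box) (hDb w₁ hAw1b hw1box)
  have v12 := hdict u₁ w₂ hu1a hu1b hw2a hw2b (hDa u₁ hAau1 hu1box) (hDb w₂ hAw2b hw2box)
  have v21 := hdict u₂ w₁ hu2a hu2b hw1a hw1b (hDa u₂ hAau2 hu2box) (hDb w₁ hAw1b hw1box)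
  have v22 := hdict u₂ w₂ hu2a hu2b hw2a hw2b (hDa u₂ hAau2 hu2box) (hDb w₂ hAw2b hw2box)
  rw [v11, v12, v21, v22] at ineq
  clear hdict hDa hDb v11 v12 v21 v22 h2 hfix hM hS
  -- cancel `x ^ 4` and return to `ℝ≥0∞`
  have hZ0 : ∀ p q, 0 ≤ Z p q := fun p q => by rw [hZ]; exact ENNReal.toReal_nonneg
  have real_ineq : Z u₂ w₁ * Z u₁ w₂ ≤ Z u₁ w₁ * Z u₂ w₂ := by
    refine le_of_mul_le_mul_left ?_ (pow_pos hx0 4)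
    nlinarith [ineq]
  have hK : ∀ p q, pathKernel G x p q = ENNReal.ofReal (Z p q) := fun p q => by
    rw [hZ, ENNReal.ofReal_toReal (BoundaryTP2.pathKernel_ne_top hGfin x p q)]
  rw [hK u₂ w₁, hK u₁ w₂, hK u₁ w₁, hK u₂ w₂, ← ENNReal.ofReal_mul (hZ0 u₂ w₁),
    ← ENNReal.ofReal_mul (hZ0 u₁ w₁)]
  exact ENNReal.ofReal_le_ofReal real_ineq

end CornerMinorOfIneq

open CornerMinorOfIneq in
/-- STUB T11 `stub_cornerMinorOfIneq` of line `corner-localisation` (crux `LeftRightFKG`,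
stmt-CriticalPhenomena-11232): THE BOTTOM-CORNER MINOR FROM ONE INEQUALITY, AT EVERY FUGACITY. On a box
realised abstractly (`Ω_1` = lattice adjacency inside the open box `(x₀, x₁) × (y₀, y₁)`, width `≥ 4`,
height `≥ 3`) with the marked points at the bottom corners `a = (x₀+1, y₀+1)`, `b = (x₁-1, y₀+1)`:
(i) `{first step North}` and `{last step from the North}` are `≼`-up-closed; (ii) for every `0 < x`, the ONE
inequality `μ(E) μ(F) ≤ μ(univ) μ(E ∩ F)` of `μx x` for these events yields (class dictionary at `k = m = 0`)
the TP₂ corner minor `Z_G(u₂,w₁) Z_G(u₁,w₂) ≤ Z_G(u₁,w₁) Z_G(u₂,w₂)` of the fugacity-`x` kernel of the free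
graph, `u₁ = (x₀+2, y₀+1)`, `u₂ = (x₀+1, y₀+2)`, `w₁ = (x₁-2, y₀+1)`, `w₂ = (x₁-1, y₀+2)`. (Fugacity-free
refactor of `stub_boxCornerMinor`.) [folklore] -/
theorem stub_cornerMinorOfIneq : ∀ (x : ℝ) (x₀ x₁ y₀ y₁ : ℤ) (C : (zdGraph 2).Walk (bx x₀ y₀) (bx x₀ y₀)),
    0 < x → x₀ + 4 ≤ x₁ → y₀ + 2 < y₁ →
    (∀ u w : Site 2, (discreteDomainGraph (dom C 1) 1).Adj u w ↔
      (zdGraph 2).Adj u w ∧ u ∈ Negative.Rect.box x₀ x₁ y₀ y₁ ∧ w ∈ Negative.Rect.box x₀ x₁ y₀ y₁) →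
    (IsUp ({γ | γ.walk.getVert 1 = bx (x₀ + 1) (y₀ + 2)} :
        Set (SAW.DomainSAW (dom C 1) 1 (bx (x₀ + 1) (y₀ + 1)) (bx (x₁ - 1) (y₀ + 1)))) ∧
      IsUp ({γ | γ.walk.reverse.getVert 1 = bx (x₁ - 1) (y₀ + 2)} :
        Set (SAW.DomainSAW (dom C 1) 1 (bx (x₀ + 1) (y₀ + 1)) (bx (x₁ - 1) (y₀ + 1))))) ∧
    (μx x (dom C 1) 1 (bx (x₀ + 1) (y₀ + 1)) (bx (x₁ - 1) (y₀ + 1)) {γ | γ.walk.getVert 1 = bx (x₀ + 1) (y₀ + 2)} *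
        μx x (dom C 1) 1 (bx (x₀ + 1) (y₀ + 1)) (bx (x₁ - 1) (y₀ + 1)) {γ | γ.walk.reverse.getVert 1 = bx (x₁ - 1) (y₀ + 2)} ≤
      μx x (dom C 1) 1 (bx (x₀ + 1) (y₀ + 1)) (bx (x₁ - 1) (y₀ + 1)) Set.univ *
        μx x (dom C 1) 1 (bx (x₀ + 1) (y₀ + 1)) (bx (x₁ - 1) (y₀ + 1))
          ({γ | γ.walk.getVert 1 = bx (x₀ + 1) (y₀ + 2)} ∩ {γ | γ.walk.reverse.getVert 1 = bx (x₁ - 1) (y₀ + 2)}) →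
      ∀ G : SimpleGraph (Site 2),
        G = freeGraph (dom C 1) 1 0 (fun _ => bx (x₀ + 1) (y₀ + 1)) 0 (fun _ => bx (x₁ - 1) (y₀ + 1)) →
        pathKernel G x (bx (x₀ + 1) (y₀ + 2)) (bx (x₁ - 2) (y₀ + 1)) * pathKernel G x (bx (x₀ + 2) (y₀ + 1)) (bx (x₁ - 1) (y₀ + 2)) ≤
          pathKernel G x (bx (x₀ + 2) (y₀ + 1)) (bx (x₁ - 2) (y₀ + 1)) * pathKernel G x (bx (x₀ + 1) (y₀ + 2)) (bx (x₁ - 1) (y₀ + 2))) := by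
  intro x x₀ x₁ y₀ y₁ C hx0 hx hy hadj
  exact ⟨isUp_pair hadj hx rfl rfl (u₁ := bx (x₀ + 2) (y₀ + 1)) rfl rfl (w₁ := bx (x₁ - 2) (y₀ + 1)) rfl rfl
      (fun _ => Iff.rfl) (fun _ => Iff.rfl),
    fun key G hG => minor_of_ineq hx0 hadj hx hy rfl rfl rfl rfl rfl rfl (fun _ => Iff.rfl) (fun _ => Iff.rfl)
      key hG⟩

end Summit.CriticalPhenomena.SAWScalingLimit.Theorems.LeftRightFKG.Families

end
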